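import Summits.AtomisticToContinuum.HydrodynamicLimit.Theses.AntiMazurCoboundaries
import Summits.AtomisticToContinuum.HydrodynamicLimit.Theses.FluxGibbsianityLdDrude
import Summits.AtomisticToContinuum.HydrodynamicLimit.Theorems.AntiMazurCoboundariesKineticWindowGronwallLadderAssembly
import Summits.AtomisticToContinuum.HydrodynamicLimit.Theorems.AntiMazurCoboundariesKineticWindowGronwallClockFromInstance
import Summits.AtomisticToContinuum.HydrodynamicLimit.Theorems.AntiMazurCoboundariesKineticWindowGronwallReorthCut
import Summits.AtomisticToContinuum.HydrodynamicLimit.Theorems.AntiMazurCoboundariesKineticWindowGronwallProductKineticInstance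
import HarnessLib

/-!
# End state of line `rare-band-ladder-dock` for crux `KineticWindowGronwall` (stmt-AtomisticToContinuum-9282)

With the four provable stubs of the registered skeleton LANDED — `stub_reorthCut` (the static re-orthogonalising cut),
`stub_ladderAssembly` (the amplitude ladder; the crux's antecedent `KineticFluxLdDecay` CONSUMED at its own amplitude on the bounded piece
of the cut), `stub_productKineticInstance` (the local product node ⇒ the landed kinetic instance KC1's output) and `stub_clockFromInstance`
(the landed one-window heart re-run on KC1's output, unguarded by dilute self-consistency, to `RelEntropyVanishing` verbatim) — the crux is
reduced, kernel-checked, to exactly THREE named open inputs: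

* `RareBandLdDecay` — the line's NEW equilibrium large-deviation lemma (window LD decay at global equilibrium for band-supported
  quadratic one-body profiles; strictly weaker than every re-typing of stmt-10967 on record and not implying it);
* `LocalTransferQ := QuadraticClassLdDecay → LocalQuadraticWindowLDFamily` — the shared kinetic wall in transfer form (the open content of
  TwoClocks stmt-14443 / 16625-S3b, product class);
* `SharedInputs` — the landed heart's other inputs BY NAME (local clamped transfer window LD along families, weighted coherence,
  `TransferActivityTails` stmt-16624, `EnergyCurrentTails` stmt-9235, `DiluteSelfConsistency` stmt-3091).

Main theorem `kineticWindowGronwall_of_open : RareBandLdDecay → LocalTransferQ → SharedInputs → KineticWindowGronwall` (registered helper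
stub `stub_cruxOfOpenInputs : CruxOfOpenInputs`); `quadraticClass_iff : QuadraticClassLdDecay ↔ KineticFluxLdDecay ∧ RareBandLdDecay`
(the ladder is LOSSLESS: the W1 half of the record's typing debt is exactly the rare band). Also recorded, for the planners:
`relEntropyVanishing_of_lineInputs` — the route's TARGET stmt-0766 (hence this crux, `fun _ => ·`) from the sibling heart's six inputs
`HydroLimitInBandOfHeart.LineInputs` and `DiluteSelfConsistency` ALONE (no statement of this line involved): what the tree closes TODAY.
Statements `LocalQuadraticWindowLDFamily`, `LocalTransferQ`, `SharedInputs`, `CruxOfOpenInputs` are re-declared verbatim from the skeleton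
(`Cruxes/KineticWindowGronwall/Lines/rare_band_ladder_dock.lean`); the four landed stub statements are imported.
-/

noncomputable section

open scoped BigOperators ENNReal
open MeasureTheory Set
open Literature.MathematicalPhysics.KineticTheory Literature.Analysis.FluidPDE Literature.Analysis.FunctionSpaces

namespace Summit.AtomisticToContinuum.HydrodynamicLimit.Theorems.KineticWindowGronwallEndState

open Summit.AtomisticToContinuum.HydrodynamicLimit.Theses.AntiMazurCoboundaries (KineticFluxLdDecay RelEntropyVanishing
  KineticWindowGronwall)
open Summit.AtomisticToContinuum.HydrodynamicLimit.Theses.TwoClocks (TransferActivityTails EnergyCurrentTails DiluteSelfConsistency)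
open Summit.AtomisticToContinuum.HydrodynamicLimit.Theorems.KineticWindowGronwallLadder (TFlow Orth RareBandLdDecay QuadraticClassLdDecay
  ReorthogonalisingCut LadderAssembly stub_ladderAssembly)
open Summit.AtomisticToContinuum.HydrodynamicLimit.Theorems.KineticWindowGronwallClockFromInstance (KineticInstanceOut ClockFromInstance
  stub_clockFromInstance relEntropyVanishing_of_gronwallCoreInBand)
open Summit.AtomisticToContinuum.HydrodynamicLimit.Theorems.HydroLimitInBandOfHeart (LocalClampedTransferWindowLDFamily
  CoherentSuprathermalContentVanishesW LineInputs gronwallCoreInBand_of_heart)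

/-! ## §1 Statements (verbatim from the registered skeleton) -/

/-- **THE DOCKING NODE OF THE LINE: local quadratic-class window LD in PRODUCT FORM along families** (verbatim from the skeleton; an
OPEN local large-deviation statement — the consequent of the shared kinetic wall). -/
def LocalQuadraticWindowLDFamily : Prop :=
  ∃ η₀ : ℝ, 0 < η₀ ∧ ∀ (t₁ : ℝ) (a θ₀ : ℝ → T3 → ℝ) (u₀ : ℝ → T3 → V3),
    Continuous (Function.uncurry a) → Continuous (Function.uncurry θ₀) → Continuous (Function.uncurry u₀) →
    (∀ s x, 0 < a s x) → (∀ s x, 0 < θ₀ s x) →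
    ∀ σ : ℝ, 0 < σ → (∀ s ∈ Set.Icc 0 t₁, σ ^ 3 * (⨆ x, a s x) ≤ η₀ * ∫ x, a s x) →
    ∃ cstar : ℝ, 0 < cstar ∧
    ∀ Φ : (N : ℕ) → TFlow σ N,
    ∀ (φ : ℝ → T3 → ℝ) (g : V3 → ℝ), Continuous (Function.uncurry φ) → Continuous g →
      (∀ s x, |φ s x| ≤ 1) → (∀ w, |g w| ≤ cstar * (1 + ‖w‖ ^ 2)) → Orth g →
      ∀ ε : ℝ, 0 < ε → ∃ τ₀ : ℝ, 0 < τ₀ ∧ ∀ τ : ℝ, τ₀ ≤ τ → ∃ N₀ : ℕ, ∀ N : ℕ, N₀ ≤ N →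
      ∀ s ∈ Set.Icc 0 t₁,
        ∫⁻ z, ENNReal.ofReal (Real.exp (∑ i : Fin (N + 1),
            (τ * ((N : ℝ) + 1) ^ (-(1 / 3 : ℝ)))⁻¹ *
              ∫ r in (0 : ℝ)..(τ * ((N : ℝ) + 1) ^ (-(1 / 3 : ℝ))),
                φ s ((Φ N).flow r z i).1 *
                  g ((Real.sqrt (θ₀ s ((Φ N).flow r z i).1))⁻¹ •
                    (((Φ N).flow r z i).2 - u₀ s ((Φ N).flow r z i).1))))
          ∂(localGibbsLaw σ (a s) (u₀ s) (θ₀ s) N (Φ N)) ≤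
        ENNReal.ofReal (Real.exp (ε * ((N : ℝ) + 1)))

/-- **THE LOCAL TRANSFER** (verbatim from the skeleton; crux-sized, the shared kinetic wall in transfer form — OPEN). -/
def LocalTransferQ : Prop :=
  QuadraticClassLdDecay → LocalQuadraticWindowLDFamily

/-- **THE SHARED INPUTS OF THE HEART, BY NAME** (verbatim from the skeleton; five board items / filed split children — OPEN). -/
def SharedInputs : Prop :=
  LocalClampedTransferWindowLDFamily ∧ CoherentSuprathermalContentVanishesW ∧ TransferActivityTails ∧
    EnergyCurrentTails ∧ DiluteSelfConsistency

/-- **THE CRUX FROM ITS THREE OPEN INPUTS** (signature of the registered helper stub `stub_cruxOfOpenInputs`; the end state of the line). -/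
def CruxOfOpenInputs : Prop :=
  RareBandLdDecay → LocalTransferQ → SharedInputs → KineticWindowGronwall

/-- Sanity: the product kinetic instance's antecedent is this file's `LocalQuadraticWindowLDFamily` (same term). -/
example : KineticWindowGronwallProductKineticInstance.ProductKineticInstance = (LocalQuadraticWindowLDFamily → KineticInstanceOut) := rfl

/-! ## §2 The end state -/

/-- **THE CRUX FROM ITS THREE OPEN INPUTS.** `RareBandLdDecay → LocalTransferQ → SharedInputs → KineticWindowGronwall`: the antecedent A
of the crux enters the LANDED ladder (`stub_ladderAssembly` over the LANDED cut `stub_reorthCut`) at its own amplitude, the rare band supplies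
the far tail, the transfer localises the quadratic class along the Euler family, the LANDED product kinetic instance
(`stub_productKineticInstance`) feeds the LANDED clock (`stub_clockFromInstance`), which reaches `RelEntropyVanishing` verbatim with the
shared inputs. [cite: OllaVaradhanYau1993, §2–3; Yau1991, §2] -/
theorem kineticWindowGronwall_of_open (h₁ : RareBandLdDecay) (h₄ : LocalTransferQ) (h₇ : SharedInputs) : KineticWindowGronwall :=
  fun hA =>
    stub_clockFromInstance
      (KineticWindowGronwallProductKineticInstance.stub_productKineticInstance
        (h₄ (stub_ladderAssembly KineticWindowGronwallReorthCut.stub_reorthCut hA h₁)))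
      h₇.1 h₇.2.1 h₇.2.2.1 h₇.2.2.2.1 h₇.2.2.2.2

/-- **Registered helper stub `stub_cruxOfOpenInputs`**: the end state of line `rare-band-ladder-dock`. -/
theorem stub_cruxOfOpenInputs : CruxOfOpenInputs :=
  kineticWindowGronwall_of_open

/-- The same for the item's primary decl (route FluxGibbsianityLdDrude shares stmt-9282 verbatim; same term). -/
theorem kineticWindowGronwall_of_open' (h₁ : RareBandLdDecay) (h₄ : LocalTransferQ) (h₇ : SharedInputs) :
    Summit.AtomisticToContinuum.HydrodynamicLimit.Theses.FluxGibbsianityLdDrude.KineticWindowGronwall :=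
  kineticWindowGronwall_of_open h₁ h₄ h₇

/-! ## §3 The ladder is lossless -/

/-- **The rare band is inside the quadratic class**: `QuadraticClassLdDecay → RareBandLdDecay` (`V₁ := 1`; `c⋆‖w‖² ≤ c⋆(1 + ‖w‖²)`).
[folklore] -/
theorem rareBand_of_quadraticClass (hQ : QuadraticClassLdDecay) : RareBandLdDecay := by
  intro a θ u₀ ha hθ
  obtain ⟨σ₀, hσ₀, H⟩ := hQ a θ u₀ ha hθ
  refine ⟨σ₀, hσ₀, fun σ hσ hσlt => ⟨(H σ hσ hσlt).1, ?_⟩⟩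
  obtain ⟨cstar, hc, Hc⟩ := (H σ hσ hσlt).2
  refine ⟨cstar, hc, 1, one_pos, fun φ g hφ hg hφ1 hgc _ horth δ hδ => ?_⟩
  have hgq : ∀ v, |g v| ≤ cstar * (1 + ‖v‖ ^ 2) := fun v => by
    refine (hgc v).trans ?_
    have h1 : ‖v‖ ^ 2 ≤ 1 + ‖v‖ ^ 2 := le_add_of_nonneg_left zero_le_one
    exact mul_le_mul_of_nonneg_left h1 hc.le
  exact Hc φ g hφ hg hφ1 hgq horth δ hδ

/-- **The bounded class is inside the quadratic class**: `QuadraticClassLdDecay → KineticFluxLdDecay` (`κ ≤ κ(1 + ‖v‖²)`). [folklore] -/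
theorem kineticFluxLdDecay_of_quadraticClass (hQ : QuadraticClassLdDecay) : KineticFluxLdDecay := by
  intro a θ u₀ ha hθ
  obtain ⟨σ₀, hσ₀, H⟩ := hQ a θ u₀ ha hθ
  refine ⟨σ₀, hσ₀, fun σ hσ hσlt => ⟨(H σ hσ hσlt).1, ?_⟩⟩
  obtain ⟨cstar, hc, Hc⟩ := (H σ hσ hσlt).2
  refine ⟨cstar, hc, fun φ g hφ hg hφ1 hgκ horth δ hδ => ?_⟩
  have hgq : ∀ v, |g v| ≤ cstar * (1 + ‖v‖ ^ 2) := fun v => by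
    refine (hgκ v).trans ?_
    have h1 : (1 : ℝ) ≤ 1 + ‖v‖ ^ 2 := le_add_of_nonneg_right (sq_nonneg _)
    simpa using mul_le_mul_of_nonneg_left h1 hc.le
  exact Hc φ g hφ hg hφ1 hgq horth δ hδ

/-- **THE LADDER IS LOSSLESS**: `QuadraticClassLdDecay ↔ KineticFluxLdDecay ∧ RareBandLdDecay` (the cut and the ladder are landed). The W1
(amplitude/class) half of the record's typing debt `A → A⁺` is therefore EXACTLY the rare band — no more, no less. [folklore] -/
theorem quadraticClass_iff : QuadraticClassLdDecay ↔ (KineticFluxLdDecay ∧ RareBandLdDecay) :=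
  ⟨fun hQ => ⟨kineticFluxLdDecay_of_quadraticClass hQ, rareBand_of_quadraticClass hQ⟩,
    fun h => stub_ladderAssembly KineticWindowGronwallReorthCut.stub_reorthCut h.1 h.2⟩

/-! ## §4 What the tree closes today around this crux, for the planners -/

/-- **The route's TARGET from the sibling heart's inputs and dilute self-consistency alone.** `LineInputs` (the six conjecture-grade inputs
of the landed one-window heart of cruxes 9133/14680: local clamped transfer window LD along families, energy-activity tails, weighted
coherence, KCWU along families stmt-16659, collision-activity tails stmt-13734, energy-current tails stmt-9235) and `DiluteSelfConsistency`
(stmt-3091) give `RelEntropyVanishing` (stmt-0766) verbatim: the landed `gronwallCoreInBand_of_heart` over the sorry-free heart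
`HydroLimitInBandSplit.oneWindowLedger_holds` and the landed window continuity, unguarded by `relEntropyVanishing_of_gronwallCoreInBand`.
No statement of this line is involved. [cite: Yau1991, §2] -/
theorem relEntropyVanishing_of_lineInputs (hI : LineInputs) (hD : DiluteSelfConsistency) : RelEntropyVanishing :=
  relEntropyVanishing_of_gronwallCoreInBand
    (gronwallCoreInBand_of_heart HydroLimitInBandSplit.oneWindowLedger_holds HydroLimitInBandContinuity.stub_windowContinuityInBand hI) hD

/-- … hence the crux from the same (its antecedent idle in THIS composition — Disproof §1 `crux_of_consequent`): the comparison point for the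
line's end state `kineticWindowGronwall_of_open`, which replaces KCWU-along-families (stmt-16659) by `A ∧ RareBandLdDecay ∧ LocalTransferQ`.
[folklore] -/
theorem kineticWindowGronwall_of_lineInputs (hI : LineInputs) (hD : DiluteSelfConsistency) : KineticWindowGronwall :=
  fun _ => relEntropyVanishing_of_lineInputs hI hD

end Summit.AtomisticToContinuum.HydrodynamicLimit.Theorems.KineticWindowGronwallEndState

end
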